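import Mathlib
import HarnessLib
import Summits.ResolutionOfSingularities.ResolutionOfSingularities.Theorems.WildQuotientsWildQuotientResolutionToricExitJordanThreeBricks
import Summits.ResolutionOfSingularities.ResolutionOfSingularities.Theorems.WildQuotientsWildQuotientResolutionBlowupExitVertexPresentation

/-!
# V3U-F: the J₃ cone brick `HPa` from the ring-level brick `Hₐ` (second-level scaffold)
(crux stmt-ResolutionOfSingularities-15640 `WildQuotients.WildQuotientResolution`, line `Sketch`;
chain w45c programme V3U, `L/w45c/CHAIN.md` v7.x §4 (RULING 06:54Z (2)/(3): Hₐ → res-type-035,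
F1 → lead-1); [OURS · L1 W4.5c] — NOT a statement of any manuscript.)

`ToricExit.coneBrick_a_of_ringBrick`: the cone brick `HPa` of the J₃ scaffold
`ToricExit.jordanThree_hasResolution_of_bricks` (p496627) — VERBATIM its binder type, ∀-form —
follows from the RING-LEVEL brick `Hₐ` = the hypothesis `H` of
`BlowupExit.exists_isBlowup_regular_of_vertexPresentation` (p505172) at
«`u := ι₀ x_a`, `κ := Unit`, `y _ := ι₀ (x_b²)`, `F₀ := Set.range ![x_a, x_b²]`, `O := Oa`»: for the single
chart ratio `T = π^*(x_b²)/π^*x_a` on `V[x_a]`, a presentation `ψ : R₀ → Γ(Oa)` of the invariant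
ring (injective, range = invariants) and a radical `J₀` with regular affine blow-up such that
`√(ψ⁻¹⟨π^*x_a, π^*x_b², T⟩|_Oa) = J₀` (of record: `R₀ = k[y]/(y_P y_R − y_Q²)` via
`ToricExit.conePresentation`, C3 p489405, C4 p485904). Conversions done here: `V(I₂) = V(x_a, x_b²)`
(`PrimeSpectrum.zeroLocus_span`), `⨆ over Unit = the chart`, and the ∀-form from the ∃-form by
uniqueness of blowing ups (`IsBlowup.unique`, `Scheme.IsRegular.of_iso`).
-/

-- single-problem summit: the doubled namespace component `ResolutionOfSingularities` is forced
set_option linter.dupNamespace false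

noncomputable section

open CategoryTheory AlgebraicGeometry TopologicalSpace MvPolynomial
open Literature.AlgebraicGeometry.Resolution Literature.AlgebraicGeometry.RelativeSpec

namespace Summit.ResolutionOfSingularities.ResolutionOfSingularities.Theorems.WildQuotientResolution.ToricExit

-- the statement is long (literal binder types of the scaffold); elaboration needs head-room
set_option maxHeartbeats 1600000 in
/-- **The J₃ cone brick `HPa` from the ring-level brick `Hₐ`** (see the module docstring).
[OURS · L1 W4.5c] [folklore; assembly of landed decls] -/
theorem coneBrick_a_of_ringBrick (k : Type) [Field k] (n : ℕ)
    (σ : MvPolynomial (Fin n) k ≃ₐ[k] MvPolynomial (Fin n) k) [Finite ↥(Subgroup.zpowers σ)]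
    (a b c : Fin n) (hab : a ≠ b) (hac : a ≠ c)
    (hb : σ (X b) = X b + X a) (hσ : ∀ i, i ≠ b → i ≠ c → σ (X i) = X i)
    (Hₐ : ∀ (ρ : ↥(Subgroup.zpowers σ) →* Aut (Spec (CommRingCat.of (MvPolynomial (Fin n) k))))
      (hρ : ∀ g : ↥(Subgroup.zpowers σ), (ρ g).hom = Spec.map (CommRingCat.ofHom
        ((MulSemiringAction.toRingEquiv (↥(Subgroup.zpowers σ)) (MvPolynomial (Fin n) k) g⁻¹ :
          MvPolynomial (Fin n) k ≃+* MvPolynomial (Fin n) k) :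
            MvPolynomial (Fin n) k →+* MvPolynomial (Fin n) k)))
      (ρB : ActionOver (affineBlowup.π (Ideal.span (Set.range (![X a, X b ^ 2] : Fin 2 → MvPolynomial (Fin n) k))) ≫ Spec.map (CommRingCat.ofHom (algebraMap (FixedPoints.subalgebra k (MvPolynomial (Fin n) k) (Subgroup.zpowers σ)) (MvPolynomial (Fin n) k)))) ↥(Subgroup.zpowers σ))
      (_ : ρB.aut = (affineBlowup.isBlowup (Ideal.span (Set.range (![X a, X b ^ 2] : Fin 2 → MvPolynomial (Fin n) k)))).liftAction ρ
          (idealSheaf_centre_comap k n σ a b c hab hac hb hσ ρ hρ))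
      (Oa : ρB.StableAffineOpens) (_ : Oa.1 = blowupChart (affineBlowup.π (Ideal.span (Set.range (![X a, X b ^ 2] : Fin 2 → MvPolynomial (Fin n) k)))) (affineBlowup.idealSheaf (Ideal.span (Set.range (![X a, X b ^ 2] : Fin 2 → MvPolynomial (Fin n) k)))) ⟨⊤, isAffineOpen_top _⟩ ((Scheme.ΓSpecIso (CommRingCat.of (MvPolynomial (Fin n) k))).inv.hom (X a)))
      (hle : ((Oa.1.ι ≫ affineBlowup.π (Ideal.span (Set.range (![X a, X b ^ 2] : Fin 2 → MvPolynomial (Fin n) k))) ≫ Spec.map (CommRingCat.ofHom (algebraMap (FixedPoints.subalgebra k (MvPolynomial (Fin n) k) (Subgroup.zpowers σ)) (MvPolynomial (Fin n) k)))) ⁻¹ᵁ ⊤ : (Oa.1 : Scheme.{0}).Opens) ≤ Oa.1.ι ⁻¹ᵁ blowupChart (affineBlowup.π (Ideal.span (Set.range (![X a, X b ^ 2] : Fin 2 → MvPolynomial (Fin n) k)))) (affineBlowup.idealSheaf (Ideal.span (Set.range (![X a, X b ^ 2] : Fin 2 → MvPolynomial (Fin n) k)))) ⟨⊤, isAffineOpen_top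 _⟩ ((Scheme.ΓSpecIso (CommRingCat.of (MvPolynomial (Fin n) k))).inv.hom (X a)))
      (T : Unit → Γ(affineBlowup (Ideal.span (Set.range (![X a, X b ^ 2] : Fin 2 → MvPolynomial (Fin n) k))), blowupChart (affineBlowup.π (Ideal.span (Set.range (![X a, X b ^ 2] : Fin 2 → MvPolynomial (Fin n) k)))) (affineBlowup.idealSheaf (Ideal.span (Set.range (![X a, X b ^ 2] : Fin 2 → MvPolynomial (Fin n) k)))) ⟨⊤, isAffineOpen_top _⟩ ((Scheme.ΓSpecIso (CommRingCat.of (MvPolynomial (Fin n) k))).inv.hom (X a))))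
      (_ : ∀ j, (affineBlowup.π (Ideal.span (Set.range (![X a, X b ^ 2] : Fin 2 → MvPolynomial (Fin n) k)))).appLE ⊤ (blowupChart (affineBlowup.π (Ideal.span (Set.range (![X a, X b ^ 2] : Fin 2 → MvPolynomial (Fin n) k)))) (affineBlowup.idealSheaf (Ideal.span (Set.range (![X a, X b ^ 2] : Fin 2 → MvPolynomial (Fin n) k)))) ⟨⊤, isAffineOpen_top _⟩ ((Scheme.ΓSpecIso (CommRingCat.of (MvPolynomial (Fin n) k))).inv.hom (X a))) (blowupChart_le_preimage (affineBlowup.π (Ideal.span (Set.range (![X a, X b ^ 2] : Fin 2 → MvPolynomial (Fin n) k)))) (affineBlowup.idealSheaf (Ideal.span (Set.range (![X a, X b ^ 2] : Fin 2 → MvPolynomial (Fin n) k)))) ⟨⊤, isAffineOpen_top _⟩ ((Scheme.ΓSpecIso (CommRingCat.of (MvPolynomial (Fin n) k))).inv.hom (X a))) ((Scheme.ΓSpecIso (CommRingCat.of (MvPolynomial (Fin n) k))).inv.hom (X b ^ 2)) =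
        (affineBlowup.π (Ideal.span (Set.range (![X a, X b ^ 2] : Fin 2 → MvPolynomial (Fin n) k)))).appLE ⊤ (blowupChart (affineBlowup.π (Ideal.span (Set.range (![X a, X b ^ 2] : Fin 2 → MvPolynomial (Fin n) k)))) (affineBlowup.idealSheaf (Ideal.span (Set.range (![X a, X b ^ 2] : Fin 2 → MvPolynomial (Fin n) k)))) ⟨⊤, isAffineOpen_top _⟩ ((Scheme.ΓSpecIso (CommRingCat.of (MvPolynomial (Fin n) k))).inv.hom (X a))) (blowupChart_le_preimage (affineBlowup.π (Ideal.span (Set.range (![X a, X b ^ 2] : Fin 2 → MvPolynomial (Fin n) k)))) (affineBlowup.idealSheaf (Ideal.span (Set.range (![X a, X b ^ 2] : Fin 2 → MvPolynomial (Fin n) k)))) ⟨⊤, isAffineOpen_top _⟩ ((Scheme.ΓSpecIso (CommRingCat.of (MvPolynomial (Fin n) k))).inv.hom (X a))) ((Scheme.ΓSpecIso (CommRingCat.of (MvPolynomial (Fin n) k))).inv.hom (X a)) * T j),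
      ∃ (R₀ : Type) (_ : CommRing R₀) (J₀ : Ideal R₀)
        (ψ : R₀ →+* Γ((Oa.1 : Scheme.{0}), (Oa.1.ι ≫ affineBlowup.π (Ideal.span (Set.range (![X a, X b ^ 2] : Fin 2 → MvPolynomial (Fin n) k))) ≫ Spec.map (CommRingCat.ofHom (algebraMap (FixedPoints.subalgebra k (MvPolynomial (Fin n) k) (Subgroup.zpowers σ)) (MvPolynomial (Fin n) k)))) ⁻¹ᵁ ⊤)),
        Function.Injective ψ ∧ ψ.range = (ρB.restrict Oa.1 Oa.2.1).invariantsRing ⊤ ∧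
        J₀.IsRadical ∧ Scheme.IsRegular (affineBlowup J₀) ∧
        ((Ideal.span ((Oa.1.ι.appLE (blowupChart (affineBlowup.π (Ideal.span (Set.range (![X a, X b ^ 2] : Fin 2 → MvPolynomial (Fin n) k)))) (affineBlowup.idealSheaf (Ideal.span (Set.range (![X a, X b ^ 2] : Fin 2 → MvPolynomial (Fin n) k)))) ⟨⊤, isAffineOpen_top _⟩ ((Scheme.ΓSpecIso (CommRingCat.of (MvPolynomial (Fin n) k))).inv.hom (X a))) ((Oa.1.ι ≫ affineBlowup.π (Ideal.span (Set.range (![X a, X b ^ 2] : Fin 2 → MvPolynomial (Fin n) k))) ≫ Spec.map (CommRingCat.ofHom (algebraMap (FixedPoints.subalgebra k (MvPolynomial (Fin n) k) (Subgroup.zpowers σ)) (MvPolynomial (Fin n) k)))) ⁻¹ᵁ ⊤) hle) ''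
          (((affineBlowup.π (Ideal.span (Set.range (![X a, X b ^ 2] : Fin 2 → MvPolynomial (Fin n) k)))).appLE ⊤ (blowupChart (affineBlowup.π (Ideal.span (Set.range (![X a, X b ^ 2] : Fin 2 → MvPolynomial (Fin n) k)))) (affineBlowup.idealSheaf (Ideal.span (Set.range (![X a, X b ^ 2] : Fin 2 → MvPolynomial (Fin n) k)))) ⟨⊤, isAffineOpen_top _⟩ ((Scheme.ΓSpecIso (CommRingCat.of (MvPolynomial (Fin n) k))).inv.hom (X a))) (blowupChart_le_preimage (affineBlowup.π (Ideal.span (Set.range (![X a, X b ^ 2] : Fin 2 → MvPolynomial (Fin n) k)))) (affineBlowup.idealSheaf (Ideal.span (Set.range (![X a, X b ^ 2] : Fin 2 → MvPolynomial (Fin n) k)))) ⟨⊤, isAffineOpen_top _⟩ ((Scheme.ΓSpecIso (CommRingCat.of (MvPolynomial (Fin n) k))).inv.hom (X a)))) '' ((Scheme.ΓSpecIso (CommRingCat.of (MvPolynomial (Fin n) k))).inv ''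
              Set.range (![X a, X b ^ 2] : Fin 2 → MvPolynomial (Fin n) k)) ∪
            Set.range T))).comap ψ).radical = J₀) :
    ∀ (ρ : ↥(Subgroup.zpowers σ) →* Aut (Spec (CommRingCat.of (MvPolynomial (Fin n) k))))
      (hρ : ∀ g : ↥(Subgroup.zpowers σ), (ρ g).hom = Spec.map (CommRingCat.ofHom
        ((MulSemiringAction.toRingEquiv (↥(Subgroup.zpowers σ)) (MvPolynomial (Fin n) k) g⁻¹ :
          MvPolynomial (Fin n) k ≃+* MvPolynomial (Fin n) k) :
            MvPolynomial (Fin n) k →+* MvPolynomial (Fin n) k)))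
      (ρB : ActionOver
        (affineBlowup.π (Ideal.span (Set.range (![X a, X b ^ 2] :
          Fin 2 → MvPolynomial (Fin n) k))) ≫
          Spec.map (CommRingCat.ofHom (algebraMap
            (FixedPoints.subalgebra k (MvPolynomial (Fin n) k) (Subgroup.zpowers σ))
            (MvPolynomial (Fin n) k))))
        ↥(Subgroup.zpowers σ))
      (_ : ρB.aut = (affineBlowup.isBlowup (Ideal.span (Set.range (![X a, X b ^ 2] :
          Fin 2 → MvPolynomial (Fin n) k)))).liftAction ρ
          (idealSheaf_centre_comap k n σ a b c hab hac hb hσ ρ hρ))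
      (Oa : ρB.StableAffineOpens)
      (_ : Oa.1 = blowupChart
        (affineBlowup.π (Ideal.span (Set.range (![X a, X b ^ 2] : Fin 2 → MvPolynomial (Fin n) k))))
        (affineBlowup.idealSheaf (Ideal.span (Set.range (![X a, X b ^ 2] :
          Fin 2 → MvPolynomial (Fin n) k))))
        ⟨⊤, isAffineOpen_top _⟩
        ((Scheme.ΓSpecIso (CommRingCat.of (MvPolynomial (Fin n) k))).inv.hom (X a)))
      (Za : Closeds (ρB.pieceQuot Oa)),
      (Za : Set (ρB.pieceQuot Oa)) = (ρB.pieceMk Oa).base ''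
        (Oa.1.ι.base ⁻¹'
          ({v | (affineBlowup.π (Ideal.span (Set.range (![X a, X b ^ 2] :
              Fin 2 → MvPolynomial (Fin n) k)))).base v ∈
              PrimeSpectrum.zeroLocus (Ideal.span (Set.range (![X a, X b ^ 2] :
                Fin 2 → MvPolynomial (Fin n) k)) : Set (MvPolynomial (Fin n) k))} \
            (blowupChart
              (affineBlowup.π (Ideal.span (Set.range (![X a, X b ^ 2] :
                Fin 2 → MvPolynomial (Fin n) k))))
              (affineBlowup.idealSheaf (Ideal.span (Set.range (![X a, X b ^ 2] :
                Fin 2 → MvPolynomial (Fin n) k))))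
              ⟨⊤, isAffineOpen_top _⟩
              ((Scheme.ΓSpecIso (CommRingCat.of (MvPolynomial (Fin n) k))).inv.hom (X b ^ 2)) :
                Set _))) →
      ∀ (B' : Scheme.{0}) (pB : B' ⟶ ρB.pieceQuot Oa),
        IsBlowup pB (Scheme.IdealSheafData.vanishingIdeal Za) → Scheme.IsRegular B' := by
  classical
  -- notation
  let S : Type := MvPolynomial (Fin n) k
  let g2 : Fin 2 → S := ![X a, X b ^ 2]
  let I₂ : Ideal S := Ideal.span (Set.range g2)
  have hπ : IsBlowup (affineBlowup.π I₂) (affineBlowup.idealSheaf I₂) := affineBlowup.isBlowup I₂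
  let ι₀ : S →+* Γ(Spec (CommRingCat.of S), ⊤) := (Scheme.ΓSpecIso (CommRingCat.of S)).inv.hom
  have hIdeal : (affineBlowup.idealSheaf I₂).ideal ⟨⊤, isAffineOpen_top _⟩ = I₂.map ι₀ := by
    change (Scheme.IdealSheafData.ofIdealTop _).ideal ⟨⊤, isAffineOpen_top _⟩ = _
    rw [ideal_ofIdealTop_top]
  have hxa : ι₀ (X a) ∈ (affineBlowup.idealSheaf I₂).ideal ⟨⊤, isAffineOpen_top _⟩ := by
    rw [hIdeal]; exact Ideal.mem_map_of_mem _ (Ideal.subset_span ⟨0, rfl⟩)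
  have hxb : ι₀ (X b ^ 2) ∈ (affineBlowup.idealSheaf I₂).ideal ⟨⊤, isAffineOpen_top _⟩ := by
    rw [hIdeal]; exact Ideal.mem_map_of_mem _ (Ideal.subset_span ⟨1, rfl⟩)
  haveI : IsAffine (Spec (CommRingCat.of
    (FixedPoints.subalgebra k (MvPolynomial (Fin n) k) (Subgroup.zpowers σ)))) := inferInstance
  intro ρ hρ ρB haut Oa hOa Za hZa B' pB hpB
  have hO : Oa.1 ≤ blowupChart (affineBlowup.π I₂) (affineBlowup.idealSheaf I₂)
      ⟨⊤, isAffineOpen_top _⟩ (ι₀ (X a)) := le_of_eq hOa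
  have hle : ((Oa.1.ι ≫ affineBlowup.π I₂ ≫ Spec.map (CommRingCat.ofHom (algebraMap
      (FixedPoints.subalgebra k (MvPolynomial (Fin n) k) (Subgroup.zpowers σ))
      (MvPolynomial (Fin n) k)))) ⁻¹ᵁ ⊤ : (Oa.1 : Scheme.{0}).Opens) ≤
      Oa.1.ι ⁻¹ᵁ blowupChart (affineBlowup.π I₂) (affineBlowup.idealSheaf I₂)
        ⟨⊤, isAffineOpen_top _⟩ (ι₀ (X a)) := by
    intro x _
    rw [Scheme.Hom.mem_preimage]
    apply hO
    have hx : Oa.1.ι.base x ∈ Set.range Oa.1.ι.base := ⟨x, rfl⟩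
    rw [Scheme.Opens.range_ι] at hx
    exact hx
  -- rewrite the vertex locus into the shape of the generic lemma
  have hZa' : (Za : Set (ρB.pieceQuot Oa)) = (ρB.pieceMk Oa).base ''
      (Oa.1.ι.base ⁻¹' ({v | (affineBlowup.π I₂).base v ∈
          PrimeSpectrum.zeroLocus (Set.range g2)} \
        ((⨆ _ : Unit, blowupChart (affineBlowup.π I₂) (affineBlowup.idealSheaf I₂)
          ⟨⊤, isAffineOpen_top _⟩ (ι₀ (X b ^ 2)) : (affineBlowup I₂).Opens) :
            Set (affineBlowup I₂)))) := by
    rw [hZa, iSup_const, PrimeSpectrum.zeroLocus_span]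
  -- the ∃-form from the ring brick
  obtain ⟨B, pB₀, hpB₀, hreg⟩ := BlowupExit.exists_isBlowup_regular_of_vertexPresentation hπ _ ρB
    hxa (fun _ : Unit => ι₀ (X b ^ 2)) (fun _ => hxb) (Set.range g2) Oa hO hle
    (Hₐ ρ hρ ρB haut Oa hOa hle) Za hZa'
  -- uniqueness of blowing ups
  obtain ⟨e, -, -⟩ := hpB₀.unique hpB
  exact Scheme.IsRegular.of_iso e.hom hreg

end Summit.ResolutionOfSingularities.ResolutionOfSingularities.Theorems.WildQuotientResolution.ToricExit

end
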